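import Summits.CriticalPhenomena.SAWScalingLimit.Theorems.SAWInfinitesimalRigidityDefs
import Summits.CriticalPhenomena.CardyFormulaZ2.Theorems.CardyRotToConfR2SymmetryUpgrade.Negative.CurveTransport

/-!
# Route `SAWInfinitesimalRigidity`, item `InfinitesimalRigidity` (IR0, stmt-CriticalPhenomena-5236):
the exact restriction–Markov class is invariant under linear stretches, dilations and quarter-turns

Helper file (`--supports stmt-CriticalPhenomena-5236`). The informal item posits the class `𝒱`
(`exactRestrictionMarkovClass`: chordal, exact two-sided restriction, restriction-coupled Markov
kernel, reversible, translation covariant, simple boundary-avoiding) and says "the chordal SLE(8/3)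
family `F` is a fixed point of the DILATION ACTION on `𝒱`" and that the linear stretches
`t ↦ (e^{tM})_* F` are curves IN `𝒱`. This file proves the underlying transport facts: for a plane
homeomorphism `φ` with Borel push-forwards that NORMALISES THE TRANSLATIONS
(`∀ w, ∃ w', τ_{w'} ∘∘ φ = φ ∘∘ τ_w`, true for every real-affine `φ`), the image family
`φ_* P = pullback P (fun _ => φ⁻¹) : D ↦ φ_* (P (φ⁻¹ D))` of a family `P ∈ 𝒱` lies in `𝒱`:

* `isChordal_pullbackConst`, `isRestriction_pullbackConst`, `isRestrictionMarkov_pullbackConst`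
  (kernel `Q' D p = φ_* Q (φ⁻¹ D) (φ⁻¹_* p)`; uses `curveClass_stopAt_map`, `remainingDomain_map` of
  the CardyFormulaZ2 transport file and the discharged representative-independence facts behind
  them), `isReversible_pullbackConst`, `translationCovariant_pullbackConst`,
  `simpleAvoiding_pullbackConst`, assembled as `pullbackConst_mem_exactRestrictionMarkovClass`;
* instances: `stretchCurve_mem_exactRestrictionMarkovClass` (`(L_t^{(u)})_* F ∈ 𝒱` for `F ∈ 𝒱`:
  the stretch curve never leaves `𝒱`, so `IsDeformationCurve 𝒱 𝒯 F (stretchCurve u hu F)` reduces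
  to the differentiability of its coordinates, `isDeformationCurve_stretchCurve`),
  `pullbackConst_dil_mem` and `pullbackConst_quarterTurn_mem` (dilations and the quarter-turn ACT
  on `𝒱`); `stretchCurve_map_dil`, `velocity_stretchCurve_mem_weightDeformations_zero` and
  `stretchVelocities_subset_restrictionMarkovTangentSpace` — the stretch velocities at a dilation
  covariant `F ∈ 𝒱` ARE weight-0 tangent vectors (`sym₀(2) ⊆ T_0(F)`, the inclusion converse to
  IR0) as soon as the stretch curves have `C¹` test coordinates.

References: V. Beffara, *Is critical 2D percolation universal?* (2008) §2.2 [Beffara2008Universal]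
(`L_* F` keeps every axiom a linear map transports); W. Werner, *Lectures on two-dimensional critical
percolation* (2007) §3.2 [Werner2007] (covariance of the axioms under conformal / affine maps).
-/

noncomputable section

open Set MeasureTheory Topology Filter
open scoped NNReal ENNReal ComplexConjugate

namespace Summit.CriticalPhenomena.SAWScalingLimit.Theorems.InfinitesimalRigidity

open Literature.Probability.RandomPlanarGeometry
open Literature.Probability.RandomPlanarGeometry.ChordalFamily
open Summit.CriticalPhenomena.CardyFormulaZ2.Theorems.CardyRotToConfR2SymmetryUpgrade.Negative
  (curveClass_stopAt_map curveClass_startFrom_map remainingDomain_map)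

section Transport

variable {φ : ℂ ≃ₜ ℂ} (h₁ : Measurable (CurveClass.map ((φ : ℂ ≃ₜ ℂ) : C(ℂ, ℂ))))
  (h₂ : Measurable (CurveClass.map ((φ.symm : ℂ ≃ₜ ℂ) : C(ℂ, ℂ))))

include h₁ h₂

omit h₁ h₂ in
/-- `φ⁻¹_* (φ_* c) = c`. [folklore] -/
theorem curveClassMap_symm_map (c : CurveClass ℂ) :
    CurveClass.map ((φ.symm : ℂ ≃ₜ ℂ) : C(ℂ, ℂ)) (CurveClass.map ((φ : ℂ ≃ₜ ℂ) : C(ℂ, ℂ)) c) = c := by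
  change (CurveClass.map ((φ.symm : ℂ ≃ₜ ℂ) : C(ℂ, ℂ)) ∘ CurveClass.map ((φ : ℂ ≃ₜ ℂ) : C(ℂ, ℂ))) c = c
  rw [← CurveClass.map_homeomorph_trans, Homeomorph.self_trans_symm, CurveClass.map_homeomorph_refl,
    id]

/-- The law of a set under the image family: `(φ_* P) D A = P (φ⁻¹ D) (φ_* ⁻¹' A)` for EVERY set
`A` (`φ_*` is a measurable embedding). [folklore] -/
theorem pullbackConst_apply_set (P : ChordalFamily) (D : DobrushinDomain) (A : Set (CurveClass ℂ)) :
    pullback P (fun _ => φ.symm) D A =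
      P (D.map φ.symm) (CurveClass.map ((φ : ℂ ≃ₜ ℂ) : C(ℂ, ℂ)) ⁻¹' A) := by
  rw [pullback_const_apply, (measurableEmbedding_curveClassMap h₁ h₂).map_apply]

/-- Almost-sure statements transfer through the image family. [folklore] -/
theorem ae_pullbackConst_iff {P : ChordalFamily} {D : DobrushinDomain} {q : CurveClass ℂ → Prop} :
    (∀ᵐ γ ∂(pullback P (fun _ => φ.symm) D), q γ) ↔
      ∀ᵐ γ ∂(P (D.map φ.symm)), q (CurveClass.map ((φ : ℂ ≃ₜ ℂ) : C(ℂ, ℂ)) γ) := by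
  rw [pullback_const_apply, (measurableEmbedding_curveClassMap h₁ h₂).ae_map_iff]

/-- **Transport of chordality.** [cite: Werner2007, §3.2] -/
theorem isChordal_pullbackConst {P : ChordalFamily} (hP : P.IsChordal) :
    (pullback P fun _ => φ.symm).IsChordal := by
  intro D
  obtain ⟨hprob, hae⟩ := hP (D.map φ.symm)
  refine ⟨⟨by rw [pullbackConst_apply_set h₁ h₂, Set.preimage_univ, measure_univ]⟩, ?_⟩
  rw [ae_pullbackConst_iff h₁ h₂]
  filter_upwards [hae] with x hx
  obtain ⟨hs, ht, hr⟩ := hx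
  refine ⟨?_, ?_, ?_⟩
  · rw [CurveClass.source_map, hs, MarkedDomain.pt_map]
    exact φ.apply_symm_apply _
  · rw [CurveClass.target_map, ht, MarkedDomain.pt_map]
    exact φ.apply_symm_apply _
  · rw [CurveClass.range_map]
    refine (Set.image_mono hr).trans ?_
    change φ '' closure ((D.map φ.symm).carrier) ⊆ _
    rw [φ.image_closure, MarkedDomain.carrier_map, Set.image_image]
    simp

omit h₁ h₂ in
/-- Nested marked domains stay nested under `φ⁻¹`. [folklore] -/
theorem carrier_map_symm_mono {D D' : DobrushinDomain} (h : D'.carrier ⊆ D.carrier) :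
    (D'.map φ.symm).carrier ⊆ (D.map φ.symm).carrier := by
  rw [MarkedDomain.carrier_map, MarkedDomain.carrier_map]; exact Set.image_mono h

/-- **Transport of two-sided restriction** (the avoidance event of `D'` pulls back to the avoidance
event of `φ⁻¹ D'`, `curveClass_preimage_map_rangeSubset_closure`). [cite: Werner2007, §3.2] -/
theorem isRestriction_pullbackConst {P : ChordalFamily} (hP : P.IsRestriction) :
    (pullback P fun _ => φ.symm).IsRestriction := by
  intro D D' hsub h0 h1 T hT
  rw [pullbackConst_apply_set h₁ h₂, pullbackConst_apply_set h₁ h₂, pullbackConst_apply_set h₁ h₂,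
    Set.preimage_inter, curveClass_preimage_map_rangeSubset_closure]
  exact hP (D.map φ.symm) (D'.map φ.symm) (carrier_map_symm_mono hsub)
    (by rw [MarkedDomain.pt_map, MarkedDomain.pt_map, h0])
    (by rw [MarkedDomain.pt_map, MarkedDomain.pt_map, h1]) _ (hT.preimage h₁)

omit h₁ h₂ in
/-- Preimage of a stopped-curve event under `φ_*` (closed `F`). [folklore] -/
theorem curveClassMap_preimage_stopAt {F : Set ℂ} (hF : IsClosed F) (S : Set (CurveClass ℂ)) :
    CurveClass.map ((φ : ℂ ≃ₜ ℂ) : C(ℂ, ℂ)) ⁻¹' (CurveClass.stopAt F ⁻¹' S) =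
      CurveClass.stopAt (((φ : ℂ ≃ₜ ℂ) : C(ℂ, ℂ)) ⁻¹' F) ⁻¹'
        (CurveClass.map ((φ : ℂ ≃ₜ ℂ) : C(ℂ, ℂ)) ⁻¹' S) := by
  ext c
  simp only [Set.mem_preimage, curveClass_stopAt_map _ hF]

omit h₁ h₂ in
/-- Preimage of a final-segment event under `φ_*` (closed `F`). [folklore] -/
theorem curveClassMap_preimage_startFrom {F : Set ℂ} (hF : IsClosed F) (T : Set (CurveClass ℂ)) :
    CurveClass.map ((φ : ℂ ≃ₜ ℂ) : C(ℂ, ℂ)) ⁻¹' (CurveClass.startFrom F ⁻¹' T) =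
      CurveClass.startFrom (((φ : ℂ ≃ₜ ℂ) : C(ℂ, ℂ)) ⁻¹' F) ⁻¹'
        (CurveClass.map ((φ : ℂ ≃ₜ ℂ) : C(ℂ, ℂ)) ⁻¹' T) := by
  ext c
  simp only [Set.mem_preimage, curveClass_startFrom_map _ hF]

/-- **Transport of the restriction-coupled domain Markov property**, kernel
`Q' D p := φ_* (Q (φ⁻¹ D) (φ⁻¹_* p))`: the clauses of `IsMarkovExtension` (curve surgery and remaining
domains commute with `φ`) and the restriction-kernel identity, clause by clause. [cite: Werner2007, §3.2 (2)] -/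
theorem isRestrictionMarkov_pullbackConst {P : ChordalFamily} (hP : P.IsRestrictionMarkov) :
    (pullback P fun _ => φ.symm).IsRestrictionMarkov := by
  obtain ⟨Q, hQ, hK⟩ := hP
  have hE := measurableEmbedding_curveClassMap h₁ h₂
  refine ⟨fun D p => (Q (D.map φ.symm) (CurveClass.map ((φ.symm : ℂ ≃ₜ ℂ) : C(ℂ, ℂ)) p)).map
    (CurveClass.map ((φ : ℂ ≃ₜ ℂ) : C(ℂ, ℂ))), ⟨?_, ?_, ?_⟩, ?_⟩
  · -- (a) nothing explored
    intro D
    have hc : CurveClass.map ((φ.symm : ℂ ≃ₜ ℂ) : C(ℂ, ℂ)) (CurveClass.mk (Curve.const (D.pt 0))) =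
        CurveClass.mk (Curve.const ((D.map φ.symm).pt 0)) := by
      rw [CurveClass.map_mk, MarkedDomain.pt_map]
      rfl
    change (Q (D.map φ.symm) (CurveClass.map ((φ.symm : ℂ ≃ₜ ℂ) : C(ℂ, ℂ))
      (CurveClass.mk (Curve.const (D.pt 0))))).map (CurveClass.map ((φ : ℂ ≃ₜ ℂ) : C(ℂ, ℂ))) = _
    rw [hc, hQ.initial, pullback_const_apply]
  · -- (b) disintegration at the first hitting of a closed set
    intro D F hF S T hS hT
    have hF' : IsClosed ((((φ : ℂ ≃ₜ ℂ) : C(ℂ, ℂ)) : ℂ → ℂ) ⁻¹' F) :=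
      hF.preimage ((φ : ℂ ≃ₜ ℂ) : C(ℂ, ℂ)).continuous
    rw [pullbackConst_apply_set h₁ h₂, Set.preimage_inter, curveClassMap_preimage_stopAt hF,
      curveClassMap_preimage_startFrom hF,
      hQ.markov (D.map φ.symm) _ hF' _ _ (hS.preimage h₁) (hT.preimage h₁)]
    change _ = ∫⁻ γ in CurveClass.stopAt F ⁻¹' S,
      (Q (D.map φ.symm) (CurveClass.map ((φ.symm : ℂ ≃ₜ ℂ) : C(ℂ, ℂ)) (CurveClass.stopAt F γ))).map
          (CurveClass.map ((φ : ℂ ≃ₜ ℂ) : C(ℂ, ℂ))) T ∂(pullback P (fun _ => φ.symm) D)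
    rw [pullback_const_apply, hE.restrict_map, hE.lintegral_map, curveClassMap_preimage_stopAt hF]
    refine lintegral_congr fun γ => ?_
    rw [hE.map_apply, curveClass_stopAt_map _ hF, curveClassMap_symm_map]
  · -- (c) dependence on the remaining marked domain only
    intro D₁ D₂ p₁ p₂ hrem htip hb
    rw [hQ.domain (D₁.map φ.symm) (D₂.map φ.symm)
      (CurveClass.map ((φ.symm : ℂ ≃ₜ ℂ) : C(ℂ, ℂ)) p₁)
      (CurveClass.map ((φ.symm : ℂ ≃ₜ ℂ) : C(ℂ, ℂ)) p₂)
      (by rw [remainingDomain_map, remainingDomain_map, hrem])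
      (by rw [CurveClass.target_map, CurveClass.target_map, htip])
      (by rw [MarkedDomain.pt_map, MarkedDomain.pt_map, hb])]
  · -- the restriction-kernel identity
    intro D p D' hsub h0 h1 T hT
    change pullback P (fun _ => φ.symm) D' T *
        (Q (D.map φ.symm) (CurveClass.map ((φ.symm : ℂ ≃ₜ ℂ) : C(ℂ, ℂ)) p)).map
          (CurveClass.map ((φ : ℂ ≃ₜ ℂ) : C(ℂ, ℂ))) _ =
      (Q (D.map φ.symm) (CurveClass.map ((φ.symm : ℂ ≃ₜ ℂ) : C(ℂ, ℂ)) p)).map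
        (CurveClass.map ((φ : ℂ ≃ₜ ℂ) : C(ℂ, ℂ))) _
    rw [pullbackConst_apply_set h₁ h₂, hE.map_apply, hE.map_apply, Set.preimage_inter,
      curveClass_preimage_map_rangeSubset_closure]
    refine hK (D.map φ.symm) _ (D'.map φ.symm) ?_ ?_ ?_ _ (hT.preimage h₁)
    · rw [remainingDomain_map, MarkedDomain.carrier_map]
      exact Set.image_mono hsub
    · rw [MarkedDomain.pt_map, CurveClass.target_map, h0]
      rfl
    · rw [MarkedDomain.pt_map, MarkedDomain.pt_map, h1]

omit h₂ in
/-- **Transport of reversibility** (time reversal commutes with push-forward,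
`CurveClass.reverse_map`). [cite: Werner2007, §3.2] -/
theorem isReversible_pullbackConst {P : ChordalFamily} (hP : P.IsReversible) :
    (pullback P fun _ => φ.symm).IsReversible := by
  intro D D' hc h0 h1
  have hrev : Measurable (CurveClass.reverse : CurveClass ℂ → CurveClass ℂ) :=
    CurveClass.isometry_reverse.continuous.measurable
  rw [pullback_const_apply, pullback_const_apply,
    hP (D.map φ.symm) (D'.map φ.symm) (by rw [MarkedDomain.carrier_map, MarkedDomain.carrier_map, hc])
      (by rw [MarkedDomain.pt_map, MarkedDomain.pt_map, h0])
      (by rw [MarkedDomain.pt_map, MarkedDomain.pt_map, h1]),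
    Measure.map_map h₁ hrev, Measure.map_map hrev h₁]
  congr 1
  funext c
  simp only [Function.comp_apply, CurveClass.reverse_map]

omit h₂ in
/-- **Transport of translation covariance** along a homeomorphism that NORMALISES the translations:
if for every `w` there is `w'` with `φ ∘ τ_{w'} = τ_w ∘ φ` (every real-affine `φ`), then
`φ_* P` is translation covariant when `P` is. [cite: Werner2007, §3.2 (1)] -/
theorem translationCovariant_pullbackConst {P : ChordalFamily}
    (hP : ∀ (D : DobrushinDomain) (w : ℂ), P (D.map (similarity 1 one_ne_zero w)) =
      (P D).map (CurveClass.map ((similarity 1 one_ne_zero w : ℂ ≃ₜ ℂ) : C(ℂ, ℂ))))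
    (hφ : ∀ w : ℂ, ∃ w' : ℂ,
      (similarity 1 one_ne_zero w').trans φ = φ.trans (similarity 1 one_ne_zero w))
    (D : DobrushinDomain) (w : ℂ) :
    pullback P (fun _ => φ.symm) (D.map (similarity 1 one_ne_zero w)) =
      (pullback P (fun _ => φ.symm) D).map
        (CurveClass.map ((similarity 1 one_ne_zero w : ℂ ≃ₜ ℂ) : C(ℂ, ℂ))) := by
  obtain ⟨w', hw'⟩ := hφ w
  have hD : (D.map (similarity 1 one_ne_zero w)).map φ.symm =
      (D.map φ.symm).map (similarity 1 one_ne_zero w') := by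
    rw [MarkedDomain.map_map, MarkedDomain.map_map]
    congr 1
    refine Homeomorph.ext fun z => φ.injective ?_
    have h := congrArg (fun ψ : ℂ ≃ₜ ℂ => ψ (φ.symm z)) hw'
    simp only [Homeomorph.trans_apply, Homeomorph.apply_symm_apply] at h
    simp only [Homeomorph.trans_apply, Homeomorph.apply_symm_apply]
    exact h.symm
  rw [pullback_const_apply, pullback_const_apply, hD, hP,
    Measure.map_map h₁ (measurable_curveClassMap_similarity _ _ _),
    Measure.map_map (measurable_curveClassMap_similarity _ _ _) h₁,
    ← CurveClass.map_homeomorph_trans, ← CurveClass.map_homeomorph_trans, hw']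

/-- **Transport of simplicity and boundary avoidance** (`φ` is injective and maps frontiers to
frontiers). [cite: Werner2007, §3.2] -/
theorem simpleAvoiding_pullbackConst {P : ChordalFamily}
    (hP : ∀ D : DobrushinDomain, ∀ᵐ γ ∂(P D),
      γ ∈ CurveClass.simple ∧ γ.range ∩ frontier D.carrier ⊆ {D.pt 0, D.pt 1})
    (D : DobrushinDomain) :
    ∀ᵐ γ ∂(pullback P (fun _ => φ.symm) D),
      γ ∈ CurveClass.simple ∧ γ.range ∩ frontier D.carrier ⊆ {D.pt 0, D.pt 1} := by
  rw [ae_pullbackConst_iff h₁ h₂]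
  filter_upwards [hP (D.map φ.symm)] with x hx
  obtain ⟨hs, hb⟩ := hx
  refine ⟨?_, ?_⟩
  · obtain ⟨γ, hγ, rfl⟩ := hs
    rw [CurveClass.map_mk]
    exact CurveClass.mk_mem_simple fun a b hab => hγ (φ.injective hab)
  · rintro z ⟨hz, hzf⟩
    rw [CurveClass.range_map] at hz
    obtain ⟨y, hy, rfl⟩ := hz
    have hyf : y ∈ frontier (D.map φ.symm).carrier := by
      rw [MarkedDomain.carrier_map, ← φ.symm.image_frontier]
      exact ⟨φ y, hzf, φ.symm_apply_apply y⟩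
    have hy2 := hb ⟨hy, hyf⟩
    simp only [MarkedDomain.pt_map, Set.mem_insert_iff, Set.mem_singleton_iff] at hy2
    change φ y ∈ ({D.pt 0, D.pt 1} : Set ℂ)
    rcases hy2 with h | h
    · rw [h, φ.apply_symm_apply]; exact Or.inl rfl
    · rw [h, φ.apply_symm_apply]; exact Or.inr rfl

/-- **`𝒱` is invariant under translation-normalising plane homeomorphisms**: if `P ∈ 𝒱`, `φ_*` and
`φ⁻¹_*` are Borel and `φ` normalises the translations, then `φ_* P ∈ 𝒱`. [cite: Beffara2008Universal, §2.2] -/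
theorem pullbackConst_mem_exactRestrictionMarkovClass {P : ChordalFamily}
    (hP : P ∈ exactRestrictionMarkovClass)
    (hφ : ∀ w : ℂ, ∃ w' : ℂ,
      (similarity 1 one_ne_zero w').trans φ = φ.trans (similarity 1 one_ne_zero w)) :
    pullback P (fun _ => φ.symm) ∈ exactRestrictionMarkovClass := by
  obtain ⟨hc, hr, hm, hv, ht, hs⟩ := hP
  exact ⟨isChordal_pullbackConst h₁ h₂ hc, isRestriction_pullbackConst h₁ h₂ hr,
    isRestrictionMarkov_pullbackConst h₁ h₂ hm, isReversible_pullbackConst h₁ hv,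
    translationCovariant_pullbackConst h₁ ht hφ, simpleAvoiding_pullbackConst h₁ h₂ hs⟩

end Transport

/-! ### Instances: stretches, dilations, the quarter-turn act on `𝒱` -/
/-- A stretch is additive: `L_t (z + z') = L_t z + L_t z'`. [folklore] -/
theorem stretchMap_add (u : ℂ) (t : ℝ) (z z' : ℂ) :
    stretchMap u t (z + z') = stretchMap u t z + stretchMap u t z' := by
  simp only [stretchMap, map_add]; ring

/-- A stretch normalises the translations: `L_t ∘ τ_{L_t⁻¹ w} = τ_w ∘ L_t`. [folklore] -/
theorem stretchHomeomorph_normalises (u : ℂ) (hu : ‖u‖ = 1) (t : ℝ) (w : ℂ) :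
    ∃ w' : ℂ, (similarity 1 one_ne_zero w').trans (stretchHomeomorph u hu t) =
      (stretchHomeomorph u hu t).trans (similarity 1 one_ne_zero w) := by
  refine ⟨stretchMap u (-t) w, Homeomorph.ext fun z => ?_⟩
  simp only [Homeomorph.trans_apply, similarity_apply, one_mul, stretchHomeomorph_apply,
    stretchMap_add]
  rw [show stretchMap u t (stretchMap u (-t) w) = w by
    simpa only [neg_neg] using stretchMap_neg_stretchMap hu (-t) w]

/-- **The stretch curve never leaves `𝒱`**: `(L_t^{(u)})_* F ∈ 𝒱` for every `t` when `F ∈ 𝒱`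
(the "`sym₀(2)`-directions are directions IN the variety" half of the sanity check behind IR0).
[cite: Beffara2008Universal, §2.2] -/
theorem stretchCurve_mem_exactRestrictionMarkovClass {F : ChordalFamily}
    (hF : F ∈ exactRestrictionMarkovClass) (u : ℂ) (hu : ‖u‖ = 1) (t : ℝ) :
    stretchCurve u hu F t ∈ exactRestrictionMarkovClass := by
  rw [stretchCurve_apply]
  refine pullbackConst_mem_exactRestrictionMarkovClass (measurable_curveClassMap_stretchHomeomorph u hu t)
    ?_ hF (stretchHomeomorph_normalises u hu t)
  rw [stretchHomeomorph_symm]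
  exact measurable_curveClassMap_stretchHomeomorph u hu (-t)

/-- Hence the stretch curve through `F ∈ 𝒱` is a deformation curve of `F` inside `𝒱` along `𝒯` as
soon as its test coordinates are `C¹` near `0` — membership of the stretch velocity in `T_0(F)`
(the inclusion `sym₀(2) ⊆ T_0`) is a pure differentiability statement. [folklore] -/
theorem isDeformationCurve_stretchCurve {F : ChordalFamily} (hF : F ∈ exactRestrictionMarkovClass)
    (u : ℂ) (hu : ‖u‖ = 1) {𝒯 : Set (CurveClass ℂ → ℝ)}
    (hC : ∀ D : DobrushinDomain, ∀ f ∈ 𝒯,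
      ContDiffAt ℝ 1 (fun t => coord (stretchCurve u hu F t) D f) 0) :
    IsDeformationCurve exactRestrictionMarkovClass 𝒯 F (stretchCurve u hu F) :=
  ⟨stretchCurve_zero u hu F,
    Eventually.of_forall fun t => stretchCurve_mem_exactRestrictionMarkovClass hF u hu t, hC⟩

/-- A centred similarity `z ↦ c z` normalises the translations (`w' = c⁻¹ w`). [folklore] -/
theorem similarity_normalises (c : ℂ) (hc : c ≠ 0) (w : ℂ) :
    ∃ w' : ℂ, (similarity 1 one_ne_zero w').trans (similarity c hc 0) =
      (similarity c hc 0).trans (similarity 1 one_ne_zero w) :=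
  ⟨c⁻¹ * w, Homeomorph.ext fun z => by
    simp only [Homeomorph.trans_apply, similarity_apply]
    field_simp
    ring⟩

/-- **Dilations act on `𝒱`.** [cite: Werner2007, §3.2 (1)] -/
theorem pullbackConst_dil_mem {P : ChordalFamily} (hP : P ∈ exactRestrictionMarkovClass)
    (r : ℝ) (hr : 0 < r) :
    pullback P (fun _ => (dil r hr.ne').symm) ∈ exactRestrictionMarkovClass := by
  refine pullbackConst_mem_exactRestrictionMarkovClass (measurable_curveClassMap_similarity _ _ _)
    ?_ hP (similarity_normalises _ _)
  rw [similarity_symm]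
  exact measurable_curveClassMap_similarity _ _ _

/-- **The quarter-turn acts on `𝒱`.** [cite: Werner2007, §3.2 (1)] -/
theorem pullbackConst_quarterTurn_mem {P : ChordalFamily} (hP : P ∈ exactRestrictionMarkovClass) :
    pullback P (fun _ => quarterTurn.symm) ∈ exactRestrictionMarkovClass :=
  pullbackConst_mem_exactRestrictionMarkovClass measurable_curveClassMap_quarterTurn
    measurable_curveClassMap_quarterTurn_symm hP (similarity_normalises _ _)

/-! ### The stretch velocities are weight-0 tangent vectors (modulo differentiability) -/
/-- Stretches commute with the dilations `z ↦ r z` (both are real-linear). [folklore] -/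
theorem stretchHomeomorph_trans_dil (u : ℂ) (hu : ‖u‖ = 1) (s : ℝ) (r : ℝ) (hr : r ≠ 0) :
    (stretchHomeomorph u hu s).trans (dil r hr) = (dil r hr).trans (stretchHomeomorph u hu s) :=
  Homeomorph.ext fun z => by
    simp only [Homeomorph.trans_apply, stretchHomeomorph_apply, similarity_apply, add_zero, stretchMap,
      map_mul, Complex.conj_ofReal]
    ring

/-- **Stretched families of a dilation covariant family are dilation covariant.** [cite: Beffara2008Universal, §2.2] -/
theorem stretchCurve_map_dil {F : ChordalFamily}
    (hF : ∀ (D : DobrushinDomain) (r : ℝ) (hr : 0 < r),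
      F (D.map (dil r hr.ne')) = (F D).map (CurveClass.map ((dil r hr.ne' : ℂ ≃ₜ ℂ) : C(ℂ, ℂ))))
    (u : ℂ) (hu : ‖u‖ = 1) (t : ℝ) (D : DobrushinDomain) (r : ℝ) (hr : 0 < r) :
    stretchCurve u hu F t (D.map (dil r hr.ne')) =
      (stretchCurve u hu F t D).map (CurveClass.map ((dil r hr.ne' : ℂ ≃ₜ ℂ) : C(ℂ, ℂ))) := by
  rw [stretchCurve_apply, pullback_const_apply, pullback_const_apply, stretchHomeomorph_symm,
    MarkedDomain.map_map, ← stretchHomeomorph_trans_dil u hu (-t) r hr.ne', ← MarkedDomain.map_map,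
    hF _ r hr,
    Measure.map_map (measurable_curveClassMap_stretchHomeomorph u hu t)
      (measurable_curveClassMap_similarity _ _ _),
    Measure.map_map (measurable_curveClassMap_similarity _ _ _)
      (measurable_curveClassMap_stretchHomeomorph u hu t),
    ← CurveClass.map_homeomorph_trans, ← CurveClass.map_homeomorph_trans,
    stretchHomeomorph_trans_dil u hu t r hr.ne']

/-- Hence the stretch velocity at a dilation covariant family has weight `0`. [cite: Beffara2008Universal, §2.2] -/
theorem velocity_stretchCurve_mem_weightDeformations_zero {F : ChordalFamily}
    (hF : ∀ (D : DobrushinDomain) (r : ℝ) (hr : 0 < r),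
      F (D.map (dil r hr.ne')) = (F D).map (CurveClass.map ((dil r hr.ne' : ℂ ≃ₜ ℂ) : C(ℂ, ℂ))))
    (u : ℂ) (hu : ‖u‖ = 1) (𝒯 : Set (CurveClass ℂ → ℝ)) :
    velocity 𝒯 (stretchCurve u hu F) ∈ weightDeformations 𝒯 0 := by
  rw [mem_weightDeformations_zero_iff]
  intro r hr
  exact velocity_isCovariantUnder (measurable_curveClassMap_similarity _ _ _)
    (by rw [similarity_symm]; exact measurable_curveClassMap_similarity _ _ _)
    (Eventually.of_forall fun t D => stretchCurve_map_dil hF u hu t D r hr)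

/-- Weight-`y` deformations form a cone. [folklore] -/
theorem smul_mem_weightDeformations {𝒯 : Set (CurveClass ℂ → ℝ)} {y : ℝ} {v : Deformation}
    (hv : v ∈ weightDeformations 𝒯 y) (a : ℝ) : a • v ∈ weightDeformations 𝒯 y := by
  intro r hr D f hf hf'
  simp only [Pi.smul_apply, smul_eq_mul]
  rw [hv r hr D f hf hf']
  ring

/-- **`sym₀(2) ⊆ T_0(F)` modulo differentiability.** For a dilation covariant `F ∈ 𝒱` whose
stretch curves have `C¹` test coordinates near `0`, every stretch velocity is a weight-0 tangent
vector at `F` of `𝒱` — the inclusion converse to IR0, reduced to differentiability of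
`t ↦ ∫ f d((L_t)_* F)(D)` (for SLE(8/3): smoothness of restriction probabilities in a quasiconformal
stretch, not in the tree). [cite: Beffara2008Universal, §2.2] -/
theorem stretchVelocities_subset_restrictionMarkovTangentSpace {F : ChordalFamily}
    (hF : F ∈ exactRestrictionMarkovClass)
    (hdil : ∀ (D : DobrushinDomain) (r : ℝ) (hr : 0 < r),
      F (D.map (dil r hr.ne')) = (F D).map (CurveClass.map ((dil r hr.ne' : ℂ ≃ₜ ℂ) : C(ℂ, ℂ))))
    {𝒯 : Set (CurveClass ℂ → ℝ)}
    (hC : ∀ (u : ℂ) (hu : ‖u‖ = 1) (D : DobrushinDomain), ∀ f ∈ 𝒯,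
      ContDiffAt ℝ 1 (fun t => coord (stretchCurve u hu F t) D f) 0) :
    stretchVelocities 𝒯 F ⊆ restrictionMarkovTangentSpace 0 𝒯 F := by
  rintro v ⟨a, u, hu, rfl⟩
  exact ⟨smul_mem_tangentCone ⟨_, isDeformationCurve_stretchCurve hF u hu (hC u hu), rfl⟩ a,
    smul_mem_weightDeformations (velocity_stretchCurve_mem_weightDeformations_zero hdil u hu 𝒯) a⟩

end Summit.CriticalPhenomena.SAWScalingLimit.Theorems.InfinitesimalRigidity
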